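import Summits.ABC.IUTFork.Cor312NaivePadicBalls
import HarnessLib

/-!
# The naive model over ANY index skeleton, I: sign shells, the packet coordinate, `p`-adic cylinders

Record-only file (D-0012) of the abc-iut cell (D-0067 adjudication, ADJUDICATION-SPEC v2.1 §2 (G3) / §4 (iii);
support piece «G-NV-PROV» = abc-iut-w5-d247's successor item (i), seat abc-iut-w4-d026); TAKES NO SIDE.  Part I of
three (`Cor312NaiveProvShells` ⟵ `Cor312NaiveProvThm311` ⟵ `Cor312NaiveProvWitness`).  w5-d247's naive `p`-adic
model (`Cor312NaivePadicBalls`/`Cor312NaiveThm311`/`Cor312GapWitnessContentful`: the CONTENTFUL typed-Thm-3.11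
instance violating typed Cor. 3.12 under the natural glue) lives over c312-7's ONE-place index `toyIndex`, where
w4-d101's packet `line : Packet ≃ ℚ` exists; this seat's A-4′ provenance witness (`Cor312GapWitnessProvenance`)
lives over EVERY `T : Thm311.ThetaIndex` but on DEGENERATE Thm-3.11 data.  This file starts the merge: the volume
geometry of the naive model over an ARBITRARY index skeleton `T` (fibres `{v | v_ℚ}` with several points, so the
`(j+1)`-tensor packet `⊗_{i ∈ S^±_{j+1}} (⊕_{v | v_ℚ} ℚ)` is no longer a line).  The replacement for `line` is the
PACKET COORDINATE `coord j vQ` (project every factor to the summand of one chosen place `v₀ | v_ℚ`, multiply):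
`signShells T` (carrier `ℚ`, shell the unit ball, strip-automorphisms and Ism the sign group `{±1}` — w4-d101's
`signs`, [IUTchIII] Prop. 1.2 (vii)); `coordAt_tprod`/`coord_tprod`; `actsBySigns_of_mem_closure` — EVERY element of
the group generated by (Ind1), (Ind2) (c312-1's `Ind1Family ∪ Ind2Family`) multiplies the coordinate by `ε`,
`|ε| = 1`; `pBall p j vQ k` — the `p`-ADIC CYLINDER `{x | coord x = 0 ∨ v_p(coord x) ≥ k}` ("`λ·𝒪`"): nested,
injective in `k`, never `{0}`, never everything, FIXED by the whole (Ind1),(Ind2)-group; `pFrame` — c312-7's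
`HullFrame` of cylinders (`hull B_k = B_k`); `ballVol c` — the log-volume `μ(B_k) = −k·c` for a SCALE `c`.
HONEST SCOPE: a model of the typed signatures (regions are cylinders along one coordinate), not of the intended
objects; no judgement on print; no `Prop` fact; standard axioms. [claim: Mochizuki2012, status: disputed]
[cite: ScholzeStix2018, §2.2 pp. 9–10]
-/

noncomputable section

namespace Summit.ABC

namespace IUTFork

namespace Cor312Vol

namespace NaiveProv

open Thm311 Cor312 Cor312.IdentifiedNonVacuity Literature.IUT.LogThetaLattice

variable (T : ThetaIndex)

/-! ## 1. Sign shells over any index skeleton, and the packet coordinate -/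

/-- `log(D⊢_v) := ℚ` at EVERY `v ∈ V` of the index skeleton `T`, log-shell the unit ball, strip-automorphisms and
"Ism" both the sign group `{±1}` (abc-iut-w4-d101's `signShells`, index-generic; an `abbrev` so that the carrier
reduces to `ℚ`). [claim: Mochizuki2012, status: disputed] -/
abbrev signShells : LogShells T where
  carrier := fun _ => ℚ
  shell := fun _ => {x | |x| ≤ 1}
  stripAut := fun _ => signs
  ism := fun _ => signs
  one_mem_stripAut := fun _ => Set.mem_insert _ _
  one_mem_ism := fun _ => Set.mem_insert _ _

variable {T}

/-- A chosen place `v₀ | v_ℚ` in every (nonempty) fibre. [folklore] -/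
def fibrePt (vQ : T.VQ) : T.Fibre vQ := Classical.arbitrary _

/-- The coordinate functional of the `(j+1)`-tensor packet AT a place `v₀ | v_ℚ`: project every tensor factor
`⊕_{v | v_ℚ} ℚ` to the summand `v₀` and multiply (this seat's `GapWitnessProv.packetCoord` on the sign shells).
[folklore] -/
def coordAt (j : T.Label) (vQ : T.VQ) (v₀ : T.Fibre vQ) : (signShells T).Packet j vQ →ₗ[ℚ] ℚ :=
  (PiTensorProduct.constantBaseRingEquiv (T.Caps j) ℚ).toLinearEquiv.toLinearMap ∘ₗ
    PiTensorProduct.map fun _ : T.Caps j => (LinearMap.proj v₀ : (signShells T).Packet1 vQ →ₗ[ℚ] ℚ)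

/-- The coordinate at `v₀` of a pure tensor is the product of the `v₀`-coordinates of its factors. [folklore] -/
theorem coordAt_tprod (j : T.Label) (vQ : T.VQ) (v₀ : T.Fibre vQ) (y : T.Caps j → (signShells T).Packet1 vQ) :
    coordAt j vQ v₀ (PiTensorProduct.tprod ℚ y) = ∏ i, (y i v₀ : ℚ) := by
  unfold coordAt
  rw [LinearMap.comp_apply]
  erw [PiTensorProduct.map_tprod]
  change (PiTensorProduct.constantBaseRingEquiv (T.Caps j) ℚ)
      (PiTensorProduct.tprod ℚ fun i : T.Caps j => (y i v₀ : ℚ)) = _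
  rw [PiTensorProduct.constantBaseRingEquiv_tprod]

/-- The PACKET COORDINATE at `(j, v_ℚ)`: the coordinate functional at the chosen place `v₀ = fibrePt v_ℚ` (the
index-generic replacement for w4-d101's `line : Packet ≃ ℚ`). [folklore] -/
def coord (j : T.Label) (vQ : T.VQ) : (signShells T).Packet j vQ →ₗ[ℚ] ℚ := coordAt j vQ (fibrePt vQ)

/-- The coordinate of a pure tensor is the product of the `v₀`-coordinates of its factors. [folklore] -/
theorem coord_tprod (j : T.Label) (vQ : T.VQ) (y : T.Caps j → (signShells T).Packet1 vQ) :
    coord j vQ (PiTensorProduct.tprod ℚ y) = ∏ i, (y i (fibrePt vQ) : ℚ) :=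
  coordAt_tprod j vQ (fibrePt vQ) y

/-- The all-ones pure tensor `1 ⊗ ⋯ ⊗ 1` of a packet. [folklore] -/
def onePt (j : T.Label) (vQ : T.VQ) : (signShells T).Packet j vQ :=
  PiTensorProduct.tprod ℚ fun (_ : T.Caps j) (_ : T.Fibre vQ) => (1 : ℚ)

/-- `coord (1 ⊗ ⋯ ⊗ 1) = 1`. [folklore] -/
theorem coord_onePt (j : T.Label) (vQ : T.VQ) : coord j vQ (onePt j vQ) = 1 := by
  unfold onePt; rw [coord_tprod]; exact Finset.prod_const_one

/-- `coord (c · (1 ⊗ ⋯ ⊗ 1)) = c`: the coordinate is ONTO `ℚ`. [folklore] -/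
theorem coord_smul_onePt (j : T.Label) (vQ : T.VQ) (c : ℚ) : coord j vQ (c • onePt j vQ) = c := by
  rw [map_smul, coord_onePt, smul_eq_mul, mul_one]

/-! ## 2. The (Ind1),(Ind2)-group acts on the packet coordinate by signs -/

/-- A packet-automorphism family ACTS BY SIGNS if on every packet it multiplies the coordinate by some `ε` with
`|ε| = 1` (w4-d101's `ActsBySigns`, index-generic; a local bookkeeping predicate, not a fact). [folklore] -/
structure ActsBySigns (Φ : (signShells T).PacketAut) : Prop where
  /-- on every packet `Φ` multiplies the coordinate by a sign -/
  sign : ∀ (j : T.Label) (vQ : T.VQ), ∃ ε : ℚ, |ε| = 1 ∧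
    ∀ x : (signShells T).Packet j vQ, coord j vQ (Φ j vQ x) = ε * coord j vQ x

/-- A summand-wise sign automorphism of the 1-packet `⊕_{v | v_ℚ} ℚ` multiplies the `v₀`-coordinate by the sign it
carries at `v₀`. [folklore] -/
theorem proj_summandwise (vQ : T.VQ)
    (g : ∀ v : T.Fibre vQ, (signShells T).carrier v.1 ≃ₗ[ℚ] (signShells T).carrier v.1)
    (hg : ∀ v, g v ∈ signs) :
    ∃ s : ℚ, |s| = 1 ∧ ∀ y : (signShells T).Packet1 vQ,
      ((signShells T).summandwise vQ g y) (fibrePt vQ) = s * y (fibrePt vQ) := by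
  obtain ⟨s, hs, hgs⟩ := exists_eq_mul_of_mem_signs (hg (fibrePt vQ))
  exact ⟨s, hs, fun y => hgs _⟩

/-- A factor-wise automorphism whose factors scale the `v₀`-coordinate by `s_i` scales the packet coordinate by
`∏ s_i` (multilinearity of `⊗`). [folklore] -/
theorem coord_factorwise (j : T.Label) (vQ : T.VQ)
    (e : T.Caps j → ((signShells T).Packet1 vQ ≃ₗ[ℚ] (signShells T).Packet1 vQ)) (s : T.Caps j → ℚ)
    (he : ∀ i (y : (signShells T).Packet1 vQ), (e i y) (fibrePt vQ) = s i * y (fibrePt vQ))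
    (x : (signShells T).Packet j vQ) :
    coord j vQ ((signShells T).factorwise j vQ e x) = (∏ i, s i) * coord j vQ x := by
  have h : (coord j vQ).comp ((signShells T).factorwise j vQ e).toLinearMap =
      (∏ i, s i) • coord j vQ := by
    apply PiTensorProduct.ext
    ext y
    simp only [LinearMap.compMultilinearMap_apply]
    show coord j vQ ((signShells T).factorwise j vQ e (PiTensorProduct.tprod ℚ y)) =
      (∏ i, s i) • coord j vQ (PiTensorProduct.tprod ℚ y)
    unfold LogShells.factorwise
    erw [PiTensorProduct.congr_tprod]
    rw [coord_tprod, coord_tprod, smul_eq_mul, ← Finset.prod_mul_distrib]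
    exact Finset.prod_congr rfl fun i _ => he i (y i)
  exact congrArg (fun f : (signShells T).Packet j vQ →ₗ[ℚ] ℚ => f x) h

/-- A permutation of the tensor factors does not change the packet coordinate (a product is symmetric). [folklore] -/
theorem coord_permute (j : T.Label) (vQ : T.VQ) (σ : Equiv.Perm (T.Caps j)) (x : (signShells T).Packet j vQ) :
    coord j vQ ((signShells T).permute j vQ σ x) = coord j vQ x := by
  have h : (coord j vQ).comp ((signShells T).permute j vQ σ).toLinearMap = coord j vQ := by
    apply PiTensorProduct.ext
    ext y
    simp only [LinearMap.compMultilinearMap_apply]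
    show coord j vQ ((signShells T).permute j vQ σ (PiTensorProduct.tprod ℚ y)) =
      coord j vQ (PiTensorProduct.tprod ℚ y)
    unfold LogShells.permute
    erw [PiTensorProduct.reindex_tprod]
    rw [coord_tprod, coord_tprod]
    exact Equiv.prod_comp σ.symm fun i => (y i (fibrePt vQ) : ℚ)
  exact congrArg (fun f : (signShells T).Packet j vQ →ₗ[ℚ] ℚ => f x) h

/-- Every (Ind2)-family ("independent copies of Ism = `{±1}` on each direct summand of each factor") acts by
signs. [folklore] -/
theorem actsBySigns_of_mem_Ind2Family {Φ : (signShells T).PacketAut} (h : Φ ∈ (signShells T).Ind2Family) :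
    ActsBySigns Φ := by
  refine ⟨fun j vQ => ?_⟩
  obtain ⟨g, hg, hΦ⟩ := h j vQ
  have hs : ∀ i, ∃ s : ℚ, |s| = 1 ∧ ∀ y : (signShells T).Packet1 vQ,
      ((signShells T).summandwise vQ (g i) y) (fibrePt vQ) = s * y (fibrePt vQ) :=
    fun i => proj_summandwise vQ (g i) (hg i)
  choose s hs1 hs2 using hs
  refine ⟨∏ i, s i, abs_prod_eq_one hs1, fun x => ?_⟩
  rw [hΦ]
  exact coord_factorwise j vQ _ s hs2 x

/-- Every (Ind1)-family (a permutation of the capsule and strip-automorphisms `∈ {±1}` on every summand of every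
factor) acts by signs. [folklore] -/
theorem actsBySigns_of_mem_Ind1Family {Φ : (signShells T).PacketAut} (h : Φ ∈ (signShells T).Ind1Family) :
    ActsBySigns Φ := by
  refine ⟨fun j vQ => ?_⟩
  obtain ⟨σ, hh, hmem, hΦ⟩ := h j
  have hs : ∀ i, ∃ s : ℚ, |s| = 1 ∧ ∀ y : (signShells T).Packet1 vQ,
      ((signShells T).summandwise vQ (fun v => hh i v.1) y) (fibrePt vQ) = s * y (fibrePt vQ) :=
    fun i => proj_summandwise vQ (fun v => hh i v.1) fun v => hmem i v.1
  choose s hs1 hs2 using hs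
  refine ⟨∏ i, s i, abs_prod_eq_one hs1, fun x => ?_⟩
  have hΦ' : Φ j vQ = ((signShells T).permute j vQ σ).trans
      ((signShells T).factorwise j vQ fun i => (signShells T).summandwise vQ fun v => hh i v.1) := hΦ vQ
  rw [hΦ', LinearEquiv.trans_apply, coord_factorwise j vQ _ s hs2, coord_permute]

/-- The identity family acts by signs. [folklore] -/
theorem actsBySigns_one : ActsBySigns (1 : (signShells T).PacketAut) :=
  ⟨fun j vQ => ⟨1, abs_one, fun x => by rw [one_mul]; rfl⟩⟩

/-- Acting by signs is closed under composition. [folklore] -/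
theorem ActsBySigns.mul {Φ Ψ : (signShells T).PacketAut} (hΦ : ActsBySigns Φ) (hΨ : ActsBySigns Ψ) :
    ActsBySigns (Φ * Ψ) := by
  refine ⟨fun j vQ => ?_⟩
  obtain ⟨ε, hε, hΦε⟩ := hΦ.sign j vQ
  obtain ⟨δ, hδ, hΨδ⟩ := hΨ.sign j vQ
  refine ⟨ε * δ, by rw [abs_mul, hε, hδ, one_mul], fun x => ?_⟩
  show coord j vQ (Φ j vQ (Ψ j vQ x)) = _
  rw [hΦε, hΨδ, mul_assoc]

/-- Acting by signs is closed under inverses. [folklore] -/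
theorem ActsBySigns.inv {Φ : (signShells T).PacketAut} (hΦ : ActsBySigns Φ) : ActsBySigns Φ⁻¹ := by
  refine ⟨fun j vQ => ?_⟩
  obtain ⟨ε, hε, hΦε⟩ := hΦ.sign j vQ
  have hε0 : ε ≠ 0 := by
    intro h; rw [h, abs_zero] at hε; exact zero_ne_one hε
  refine ⟨ε⁻¹, by rw [abs_inv, hε, inv_one], fun x => ?_⟩
  show coord j vQ ((Φ j vQ).symm x) = _
  have h := hΦε ((Φ j vQ).symm x)
  rw [LinearEquiv.apply_symm_apply] at h
  rw [h, ← mul_assoc, inv_mul_cancel₀ hε0, one_mul]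

/-- **Every element of the group generated by (Ind1), (Ind2) acts by signs** on the packet coordinates of the
sign shells over any index skeleton (closure induction). [folklore] -/
theorem actsBySigns_of_mem_closure {Φ : (signShells T).PacketAut}
    (h : Φ ∈ Subgroup.closure ((signShells T).Ind1Family ∪ (signShells T).Ind2Family)) : ActsBySigns Φ := by
  induction h using Subgroup.closure_induction with
  | mem Ψ hΨ =>
    rcases hΨ with h1 | h2
    · exact actsBySigns_of_mem_Ind1Family h1
    · exact actsBySigns_of_mem_Ind2Family h2
  | one => exact actsBySigns_one
  | mul Ψ Ψ' _ _ hΨ hΨ' => exact hΨ.mul hΨ'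
  | inv Ψ _ hΨ => exact hΨ.inv

variable (p : ℕ)

/-! ## 3. `p`-adic cylinders along the packet coordinate -/

/-- The `p`-ADIC CYLINDER `B_k := {x | coord(x) = 0 ∨ v_p(coord x) ≥ k}` of "radius `p^{−k}`" in a tensor packet
(the hull-sets `λ·𝒪` of [IUTchIII] Rmk. 3.9.5 (i) in the naive model; w5-d247's `pBall` with `line ↦ coord`).
[claim: Mochizuki2012, status: disputed] -/
def pBall (j : T.Label) (vQ : T.VQ) (k : ℤ) : Set ((signShells T).Packet j vQ) :=
  {x | coord j vQ x = 0 ∨ k ≤ padicValRat p (coord j vQ x)}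

/-- `0 ∈ B_k`. [folklore] -/
theorem zero_mem_pBall (j : T.Label) (vQ : T.VQ) (k : ℤ) :
    (0 : (signShells T).Packet j vQ) ∈ pBall p j vQ k :=
  Or.inl (map_zero _)

/-- The cylinders are NESTED: `B_k ⊆ B_{k'}` for `k' ≤ k`. [folklore] -/
theorem pBall_mono (j : T.Label) (vQ : T.VQ) {k k' : ℤ} (h : k' ≤ k) : pBall p j vQ k ⊆ pBall p j vQ k' := by
  rintro x (hx | hx)
  · exact Or.inl hx
  · exact Or.inr (h.trans hx)

/-- The point `p^k · (1 ⊗ ⋯ ⊗ 1)` (coordinate `p^k`). [folklore] -/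
def pt (j : T.Label) (vQ : T.VQ) (k : ℤ) : (signShells T).Packet j vQ := ((p : ℚ) ^ k) • onePt j vQ

/-- `coord (p^k · 1) = p^k`. [folklore] -/
theorem coord_pt (j : T.Label) (vQ : T.VQ) (k : ℤ) : coord j vQ (pt p j vQ k) = (p : ℚ) ^ k :=
  coord_smul_onePt j vQ _

/-- `p^k · 1 ∈ B_k`. [folklore] -/
theorem pt_mem_pBall [hp : Fact p.Prime] (j : T.Label) (vQ : T.VQ) (k : ℤ) : pt p j vQ k ∈ pBall p j vQ k :=
  Or.inr (by rw [coord_pt, NaiveWitness.padicValRat_ppow])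

/-- `p^k · 1 ∈ B_{k'}` iff `k' ≤ k`. [folklore] -/
theorem pt_mem_pBall_iff [hp : Fact p.Prime] (j : T.Label) (vQ : T.VQ) (k k' : ℤ) :
    pt p j vQ k ∈ pBall p j vQ k' ↔ k' ≤ k := by
  constructor
  · rintro (h | h)
    · exact absurd ((coord_pt p j vQ k).symm.trans h) (NaiveWitness.ppow_ne_zero p k)
    · rwa [coord_pt, NaiveWitness.padicValRat_ppow] at h
  · intro h; exact pBall_mono p j vQ h (pt_mem_pBall p j vQ k)

/-- `B_k ⊆ B_{k'}` iff `k' ≤ k`. [folklore] -/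
theorem pBall_subset_iff [hp : Fact p.Prime] (j : T.Label) (vQ : T.VQ) (k k' : ℤ) :
    pBall p j vQ k ⊆ pBall p j vQ k' ↔ k' ≤ k :=
  ⟨fun h => (pt_mem_pBall_iff p j vQ k k').1 (h (pt_mem_pBall p j vQ k)), pBall_mono p j vQ⟩

/-- `k ↦ B_k` is injective. [folklore] -/
theorem pBall_injective [hp : Fact p.Prime] (j : T.Label) (vQ : T.VQ) : Function.Injective (pBall p j vQ) :=
  fun k k' h =>
    le_antisymm ((pBall_subset_iff p j vQ k' k).1 h.symm.le) ((pBall_subset_iff p j vQ k k').1 h.le)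

/-- `B_{k+1} ⊊ B_k`: the cylinders are PROPER subsets of one another. [folklore] -/
theorem pBall_succ_ssubset [hp : Fact p.Prime] (j : T.Label) (vQ : T.VQ) (k : ℤ) :
    pBall p j vQ (k + 1) ⊂ pBall p j vQ k :=
  ⟨pBall_mono p j vQ (by omega), fun h => by
    have := (pBall_subset_iff p j vQ k (k + 1)).1 h; omega⟩

/-- No cylinder is the whole packet (`p^{k−1} · 1 ∉ B_k`). [folklore] -/
theorem pBall_ne_univ [hp : Fact p.Prime] (j : T.Label) (vQ : T.VQ) (k : ℤ) : pBall p j vQ k ≠ Set.univ := by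
  intro h
  have := (pt_mem_pBall_iff p j vQ (k - 1) k).1 (h ▸ Set.mem_univ _)
  omega

/-- No cylinder is `{0}`. [folklore] -/
theorem pBall_ne_zero [hp : Fact p.Prime] (j : T.Label) (vQ : T.VQ) (k : ℤ) : pBall p j vQ k ≠ {0} := by
  intro h
  have h1 : pt p j vQ k ∈ ({0} : Set _) := h ▸ pt_mem_pBall p j vQ k
  have h2 := congrArg (coord j vQ) (Set.mem_singleton_iff.1 h1)
  rw [coord_pt, map_zero] at h2
  exact NaiveWitness.ppow_ne_zero p k h2

/-- **A family acting by signs FIXES every cylinder** (as a set). [folklore] -/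
theorem image_pBall_of_actsBySigns {Φ : (signShells T).PacketAut} (h : ActsBySigns Φ) (j : T.Label)
    (vQ : T.VQ) (k : ℤ) : Φ j vQ '' pBall p j vQ k = pBall p j vQ k := by
  obtain ⟨ε, hε, hΦ⟩ := h.sign j vQ
  apply Set.Subset.antisymm
  · rintro _ ⟨x, hx, rfl⟩
    show coord j vQ (Φ j vQ x) = 0 ∨ k ≤ padicValRat p (coord j vQ (Φ j vQ x))
    rw [hΦ, NaiveWitness.sign_mul_mem_pBall_iff p hε k]
    exact hx
  · intro x hx
    refine ⟨(Φ j vQ).symm x, ?_, LinearEquiv.apply_symm_apply _ _⟩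
    have h1 := hΦ ((Φ j vQ).symm x)
    rw [LinearEquiv.apply_symm_apply] at h1
    show coord j vQ ((Φ j vQ).symm x) = 0 ∨ k ≤ padicValRat p (coord j vQ ((Φ j vQ).symm x))
    rw [← NaiveWitness.sign_mul_mem_pBall_iff p hε k, ← h1]
    exact hx

/-- Every element of the group generated by (Ind1), (Ind2) fixes every cylinder. [folklore] -/
theorem image_pBall_of_mem_closure {Φ : (signShells T).PacketAut}
    (h : Φ ∈ Subgroup.closure ((signShells T).Ind1Family ∪ (signShells T).Ind2Family)) (j : T.Label)
    (vQ : T.VQ) (k : ℤ) : Φ j vQ '' pBall p j vQ k = pBall p j vQ k :=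
  image_pBall_of_actsBySigns p (actsBySigns_of_mem_closure h) j vQ k

/-! ## 4. The hull frame of cylinders and the scaled log-volume `μ(B_k) = −k·c` -/

/-- The HULL FRAME of the naive model on a packet: hull-sets the cylinders `B_k`, `k ∈ ℤ`; "relatively compact" =
inside some cylinder; "admits a hull" = bounded with an element of EXACT extremal valuation (w5-d247's `pFrame`,
`line ↦ coord`; [IUTchIII] Rmk. 3.9.5 (i)). [claim: Mochizuki2012, status: disputed] -/
def pFrame (j : T.Label) (vQ : T.VQ) : HullFrame ((signShells T).Packet j vQ) where
  Hul := Set.range (pBall p j vQ)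
  IsBounded := fun U => ∃ k, U ⊆ pBall p j vQ k
  HasHull := fun U => ∃ k, U ⊆ pBall p j vQ k ∧ ∃ x ∈ U, coord j vQ x ≠ 0 ∧ padicValRat p (coord j vQ x) = k
  hul_bounded := by rintro _ ⟨k, rfl⟩; exact ⟨k, subset_rfl⟩
  bounded_mono := fun U U' hUU' ⟨k, hk⟩ => ⟨k, hUU'.trans hk⟩
  exists_hul := fun U ⟨k, hk⟩ => ⟨pBall p j vQ k, ⟨k, rfl⟩, hk⟩
  hull_mem := by
    rintro U - ⟨k, hUk, x, hxU, hx0, hxk⟩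
    refine ⟨k, ?_⟩
    apply Set.Subset.antisymm
    · refine Set.subset_sInter ?_
      rintro H ⟨⟨k', rfl⟩, hUH⟩
      refine pBall_mono p j vQ ?_
      rcases hUH hxU with h | h
      · exact absurd h hx0
      · rwa [hxk] at h
    · exact Set.sInter_subset_of_mem ⟨⟨k, rfl⟩, hUk⟩

/-- The hull of a cylinder is itself. [folklore] -/
theorem pFrame_hull_pBall (j : T.Label) (vQ : T.VQ) (k : ℤ) :
    (pFrame p j vQ).hull (pBall p j vQ k) = pBall p j vQ k :=
  Set.Subset.antisymm ((pFrame p j vQ).hull_subset_of_mem ⟨k, rfl⟩ subset_rfl) ((pFrame p j vQ).subset_hull _)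

/-- A cylinder is bounded and admits its hull. [folklore] -/
theorem pFrame_bounded_hasHull [hp : Fact p.Prime] (j : T.Label) (vQ : T.VQ) (k : ℤ) :
    (pFrame p j vQ).IsBounded (pBall p j vQ k) ∧ (pFrame p j vQ).HasHull (pBall p j vQ k) :=
  ⟨⟨k, subset_rfl⟩, ⟨k, subset_rfl, pt p j vQ k, pt_mem_pBall p j vQ k,
    by rw [coord_pt]; exact NaiveWitness.ppow_ne_zero p k, by rw [coord_pt, NaiveWitness.padicValRat_ppow]⟩⟩

variable (c : ℝ)

open scoped Classical in
/-- The SCALED log-volume of the naive model on one packet: `μ(B_k) = −k·c` on cylinders (normalised by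
`μ(B_0) = 0`, [IUTchIII] Prop. 3.9 (i); the scale `c > 0` will be `(1/2l)·log(q)` of the initial Θ-datum), `0` on
non-cylinders (never evaluated there). [claim: Mochizuki2012, status: disputed] -/
def ballVol (j : T.Label) (vQ : T.VQ) (A : Set ((signShells T).Packet j vQ)) : ℝ :=
  if h : ∃ k, A = pBall p j vQ k then -(h.choose : ℝ) * c else 0

/-- `μ(B_k) = −k·c`. [folklore] -/
theorem ballVol_pBall [hp : Fact p.Prime] (j : T.Label) (vQ : T.VQ) (k : ℤ) :
    ballVol p c j vQ (pBall p j vQ k) = -(k : ℝ) * c := by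
  classical
  have h : ∃ k', pBall p j vQ k = pBall p j vQ k' := ⟨k, rfl⟩
  unfold ballVol
  rw [dif_pos h, pBall_injective p j vQ h.choose_spec.symm]

/-- The scaled log-volume is monotone on cylinders when `0 ≤ c`. [folklore] -/
theorem ballVol_mono [hp : Fact p.Prime] (hc : 0 ≤ c) {j : T.Label} {vQ : T.VQ} {k k' : ℤ}
    (h : pBall p j vQ k ⊆ pBall p j vQ k') :
    ballVol p c j vQ (pBall p j vQ k) ≤ ballVol p c j vQ (pBall p j vQ k') := by
  rw [ballVol_pBall, ballVol_pBall]
  have hk : (k' : ℝ) ≤ k := by exact_mod_cast (pBall_subset_iff p j vQ k k').1 h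
  nlinarith

end NaiveProv

end Cor312Vol

end IUTFork

end Summit.ABC

end
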